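import Summits.BirchSwinnertonDyer.Rank1Residual.X12.CMRamifiedRecordSchemaE
import Summits.BirchSwinnertonDyer.Rank1Residual.X12.JZeroThreeTorsionCriterion
import HarnessLib

/-!
# Leaf `CornerF ∧ p ramified in K` (K12r), slice `p = 3`: the BRIDGE from the certificate records'
# closed-form `3`-torsion bits to the route's regime predicates (cell `bsd-print-cfram`, typer seat `ty3`, PART F §1)

HONEST FRAMING (cell `bsd-print-cfram`, run/shared/lean/pub/bsd-print-cfram/, verbatim in every file
of the cell): PARTITION currency only — the leaf counts when its class theorem is in the kernel BY
NAME, flag-free; Literature named facts are statement-only with cite tags, never sorried theorems;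
every imported theorem carries its printed hypotheses verbatim; numbers, not adjectives. THIS FILE IS
STRUCTURE: theorems only, no definition, no named fact, nothing about any particular curve; no mark
moves (the leaf K12r, its `p = 3` slice `Summit.BirchSwinnertonDyer.WAllCornerFRamifiedAtThree` and the
regime children N / T / V of crux C1 — route `PrintCFram`, items stmt-BirchSwinnertonDyer-20698 /
-20699 / -20700 — stay OPEN).

## What is bridged

PART C (`FrameThreeRow`) and PART E (`RegimeRow`, `regimeCode`) decide the regime letter of a K12r@3
class `W = E_k — W' = E_{−27k} ≅ W^{(−3)}` by CLOSED FORMS on the integer `k` (`isSqQ3`, `isCubeQ3`,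
`hasLocal3Tors k = isSqQ3 k ∨ (isCubeQ3 (−4k) ∧ isSqQ3 (−3k))` = «`E_k(ℚ₃)[3] ≠ 0`», on the
fuel-recursive valuation `vp`). The route's regime predicates are the O11@3 binders `htors : ∀ Q ∈
W(ℚ₃), 3Q = 0 → Q = 0`, `htors'` (same on `W^{(−3)}`) of ty2's `X12/O11/RamifiedStrictDescentAtThree*`,
decided by p4's criterion `X12.JZeroThree.noThreeTorsion_pair_iff_of_mordell_model` (p546152) as the
congruence «`k = 3ᵃm`, `3 ∤ m`: (`a` even ∧ `m ≡ 2`) ∨ (`a` odd ∧ `m ≡ 1`) (mod 3)». So far the records'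
agreement with it was NUMERICAL (REF S16/A28: 196/196 window members); THIS FILE PROVES IT FOR ALL `k`:
§1 `vp_spec` / `vp_eq_of_eq_pow_mul` (`p ≥ 2`, `n ≠ 0`: `p^{vp} ∣ n`, `p ∤ n/p^{vp}`; `vp` is
characterised by `n = pᵇu`, `p ∤ u`), `eq_pow_mul_unit3`, `not_three_dvd_unit3`; §2 `isSqQ3_eq_true_iff`
(`isSqQ3 (3ᵃm) ⟺ a` even `∧ m ≡ 1`), `isSqQ3_neg_three_mul_iff`, `isSqQ3_iff_isSquare_padic` (`k ≠ 0`: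
`isSqQ3 k ⟺ k ∈ ℚ₃ײ`, via p4's `isSquare_padicThree_iff`), `isSqQ3_nine_mul`; §3 `tBit_eq` — ON THE
PAIR the cube clause is absorbed: `hasLocal3Tors k ∨ hasLocal3Tors (−27k) = isSqQ3 k ∨ isSqQ3 (−3k)`
for all `k` — and `tBit_eq_false_iff` (`⟺` p4's congruence); §4 **`tBit_eq_false_iff_noThreeTorsion_pair`**:
for ANY `W : WeierstrassCurve ℚ` with `C • W = (y² = x³ + k)`, `k ≠ 0`, the T-bit is `false` iff BOTH
binders hold (p4's theorem with `a := vp 3 k`, `m := unit3 k`); §5 record level: for a CONSISTENT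
`RegimeRow r` (PART E / F displays) and any such `W` for `r.k`: `r.regime ≠ 1 ⟺` both binders,
`= 0 ⟺` binders `∧ awayOK` (sub-leaf N), `= 2 ⟺` binders `∧ ¬awayOK` (V), `= 1 ⟺ W` or `W^{(−3)}` HAS
a `ℚ₃`-point `Q ≠ 0`, `3Q = 0` (T). (The Tamagawa entries behind `awayOK` remain engine data.)
beyond-print: NO (Hensel-level 3-adic algebra on integers + p4's criterion; the organisation is the cell's).

References: `X12/CMRamifiedRecordSchemaC.lean` §1 (the closed forms), `X12/CMRamifiedRecordSchemaE.lean`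
(`regimeCode`, `RegimeRow`), `X12/JZeroThreeTorsionCriterion.lean` (p4), REFEREE.md S16/A28;
[cite: Serre1973, Ch. II §3.3 Thm 3] (squares in `ℚ_p`); [cite: SilvermanAEC2009, Exercise 3.7] (ψ₃).
-/

set_option autoImplicit false

open WeierstrassCurve
open Literature.NumberTheory.EllipticCurves

namespace Summit.BirchSwinnertonDyer.Rank1Residual.X12.CMRamifiedRecords

open Summit.BirchSwinnertonDyer.BirchSwinnertonDyer.Rank1Residual.HeegnerIndexRecords

/-! ### §1 The fuel-recursive valuation `vp` is the valuation -/

/-- `vpAux p fuel n` with enough fuel (`|n| ≤ fuel`) is the exact power of `p` in `n ≠ 0` (`p ≥ 2`):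
`p^v ∣ n` and `p ∤ n / p^v`. [folklore] -/
theorem vpAux_spec {p : ℕ} (hp : 2 ≤ p) :
    ∀ (fuel : ℕ) (n : ℤ), n ≠ 0 → n.natAbs ≤ fuel →
      (p : ℤ) ^ vpAux p fuel n ∣ n ∧ ¬ (p : ℤ) ∣ n / (p : ℤ) ^ vpAux p fuel n := by
  intro fuel
  induction fuel with
  | zero =>
    intro n hn hle
    exact absurd (Int.natAbs_eq_zero.mp (Nat.le_zero.mp hle)) hn
  | succ fuel ih =>
    intro n hn hle
    have hp0 : (0 : ℤ) < (p : ℤ) := by exact_mod_cast (show 0 < p by omega)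
    by_cases hmod : n % (p : ℤ) ≠ 0
    · have hc : p ≤ 1 ∨ n = 0 ∨ n % (p : ℤ) ≠ 0 := Or.inr (Or.inr hmod)
      have hv : vpAux p (fuel + 1) n = 0 := by
        simp only [vpAux]
        rw [if_pos hc]
      rw [hv, pow_zero, Int.ediv_one]
      exact ⟨one_dvd n, fun h => hmod (Int.emod_eq_zero_of_dvd h)⟩
    · push Not at hmod
      obtain ⟨q, hq⟩ := Int.dvd_of_emod_eq_zero hmod
      have hq0 : q ≠ 0 := by
        rintro rfl
        exact hn (by rw [hq, mul_zero])
      have hnq : n / (p : ℤ) = q := by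
        rw [hq, Int.mul_ediv_cancel_left _ (ne_of_gt hp0)]
      have hc : ¬ (p ≤ 1 ∨ n = 0 ∨ n % (p : ℤ) ≠ 0) := by
        push Not
        exact ⟨by omega, hn, hmod⟩
      have hv : vpAux p (fuel + 1) n = vpAux p fuel q + 1 := by
        simp only [vpAux]
        rw [if_neg hc, hnq]
      have hle' : q.natAbs ≤ fuel := by
        have h1 : n.natAbs = p * q.natAbs := by rw [hq, Int.natAbs_mul, Int.natAbs_natCast]
        have h2 : 0 < q.natAbs := Int.natAbs_pos.mpr hq0
        have h3 : 2 * q.natAbs ≤ p * q.natAbs := Nat.mul_le_mul_right _ hp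
        omega
      obtain ⟨ih1, ih2⟩ := ih q hq0 hle'
      rw [hv, pow_succ', hq]
      refine ⟨mul_dvd_mul_left _ ih1, ?_⟩
      rw [Int.mul_ediv_mul_of_pos _ _ hp0]
      exact ih2

/-- `vp p n` (`p ≥ 2`, `n ≠ 0`) is the exact power of `p` in `n`: `p^{vp p n} ∣ n` and
`p ∤ n / p^{vp p n}`. [folklore] -/
theorem vp_spec {p : ℕ} (hp : 2 ≤ p) {n : ℤ} (hn : n ≠ 0) :
    (p : ℤ) ^ vp p n ∣ n ∧ ¬ (p : ℤ) ∣ n / (p : ℤ) ^ vp p n :=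
  vpAux_spec hp n.natAbs n hn le_rfl

/-- `vp` is characterised by the factorisation `n = pᵇ·u`, `p ∤ u`. [folklore] -/
theorem vp_eq_of_eq_pow_mul {p : ℕ} (hp : 2 ≤ p) {n u : ℤ} {b : ℕ} (hu : ¬ (p : ℤ) ∣ u)
    (h : n = (p : ℤ) ^ b * u) : vp p n = b := by
  have hu0 : u ≠ 0 := fun h0 => hu (h0 ▸ dvd_zero _)
  have hp0 : (0 : ℤ) < (p : ℤ) := by exact_mod_cast (show 0 < p by omega)
  have hpne : (p : ℤ) ≠ 0 := ne_of_gt hp0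
  have hn : n ≠ 0 := by rw [h]; exact mul_ne_zero (pow_ne_zero _ hpne) hu0
  obtain ⟨h1, h2⟩ := vp_spec hp hn
  generalize vp p n = v at h1 h2 ⊢
  rcases lt_trichotomy v b with hlt | heq | hgt
  · exfalso
    apply h2
    obtain ⟨c, hc⟩ := Nat.exists_eq_add_of_lt hlt
    subst hc
    have hsplit : n = (p : ℤ) ^ v * ((p : ℤ) ^ (c + 1) * u) := by
      rw [h]; ring
    rw [hsplit, Int.mul_ediv_cancel_left _ (pow_ne_zero _ hpne)]
    exact ⟨(p : ℤ) ^ c * u, by ring⟩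
  · exact heq
  · exfalso
    apply hu
    obtain ⟨c, hc⟩ := Nat.exists_eq_add_of_lt hgt
    subst hc
    rw [h, show b + c + 1 = b + (c + 1) by omega, pow_add] at h1
    have h3 : (p : ℤ) ^ (c + 1) ∣ u := (mul_dvd_mul_iff_left (pow_ne_zero _ hpne)).mp h1
    exact (dvd_pow_self (p : ℤ) (Nat.succ_ne_zero c)).trans h3

/-- At `p = 3`: `3^{vp 3 k} ∣ k` and `3 ∤ k / 3^{vp 3 k}` for `k ≠ 0`. [folklore] -/
theorem vp_three_spec {k : ℤ} (hk : k ≠ 0) :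
    (3 : ℤ) ^ vp 3 k ∣ k ∧ ¬ (3 : ℤ) ∣ k / (3 : ℤ) ^ vp 3 k := by
  have h := vp_spec (p := 3) (by norm_num) hk
  simpa using h

/-- `vp 3 (3ᵃ·m) = a` for `3 ∤ m`. [folklore] -/
theorem vp_three_eq {a : ℕ} {m : ℤ} (hm : ¬ (3 : ℤ) ∣ m) : vp 3 ((3 : ℤ) ^ a * m) = a :=
  vp_eq_of_eq_pow_mul (p := 3) (n := (3 : ℤ) ^ a * m) (u := m) (b := a) (by norm_num)
    (by exact_mod_cast hm) (by push_cast; ring)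

/-- `unit3 (3ᵃ·m) = m` for `3 ∤ m`. [folklore] -/
theorem unit3_eq {a : ℕ} {m : ℤ} (hm : ¬ (3 : ℤ) ∣ m) : unit3 ((3 : ℤ) ^ a * m) = m := by
  unfold unit3
  rw [vp_three_eq hm, Int.mul_ediv_cancel_left _ (pow_ne_zero _ (by norm_num))]

/-- `k = 3^{vp 3 k} · unit3 k` for `k ≠ 0`. [folklore] -/
theorem eq_pow_mul_unit3 {k : ℤ} (hk : k ≠ 0) : k = (3 : ℤ) ^ vp 3 k * unit3 k := by
  obtain ⟨h1, -⟩ := vp_three_spec hk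
  unfold unit3
  exact (Int.mul_ediv_cancel' h1).symm

/-- `3 ∤ unit3 k` for `k ≠ 0`. [folklore] -/
theorem not_three_dvd_unit3 {k : ℤ} (hk : k ≠ 0) : ¬ (3 : ℤ) ∣ unit3 k :=
  (vp_three_spec hk).2

/-- Every non-zero integer is `3ᵃ·m` with `3 ∤ m` (`a = vp 3 k`, `m = unit3 k`). [folklore] -/
theorem exists_eq_pow_mul_of_ne_zero {k : ℤ} (hk : k ≠ 0) :
    ∃ a : ℕ, ∃ m : ℤ, ¬ (3 : ℤ) ∣ m ∧ k = (3 : ℤ) ^ a * m :=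
  ⟨vp 3 k, unit3 k, not_three_dvd_unit3 hk, eq_pow_mul_unit3 hk⟩

/-! ### §2 The closed form `isSqQ3` is «square in `ℚ₃`» -/

/-- `(m : ZMod 3) = 1 ⟺ m % 3 = 1` and `(m : ZMod 3) = 2 ⟺ m % 3 = 2`. [folklore] -/
theorem intCast_zmod_three_eq_iff (m : ℤ) :
    ((m : ZMod 3) = 1 ↔ m % 3 = 1) ∧ ((m : ZMod 3) = 2 ↔ m % 3 = 2) := by
  have e : (m : ZMod 3) = ((m % 3 : ℤ) : ZMod 3) := by
    rw [ZMod.intCast_eq_intCast_iff']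
    push_cast
    omega
  have h3 : m % 3 = 0 ∨ m % 3 = 1 ∨ m % 3 = 2 := by omega
  rw [e]
  rcases h3 with h | h | h <;> rw [h] <;> decide

/-- **`isSqQ3 (3ᵃ·m)` (`3 ∤ m`) iff `a` is even and `m ≡ 1 (mod 3)`.** [cite: Serre1973, Ch. II §3.3 Thm 3] -/
theorem isSqQ3_eq_true_iff {a : ℕ} {m : ℤ} (hm : ¬ (3 : ℤ) ∣ m) :
    isSqQ3 ((3 : ℤ) ^ a * m) = true ↔ Even a ∧ (m : ZMod 3) = 1 := by
  have hm0 : m ≠ 0 := fun h => hm (h ▸ dvd_zero 3)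
  have hk0 : (3 : ℤ) ^ a * m ≠ 0 := mul_ne_zero (pow_ne_zero _ (by norm_num)) hm0
  rw [(intCast_zmod_three_eq_iff m).1, Nat.even_iff]
  simp only [isSqQ3, vp_three_eq hm, unit3_eq hm, Bool.and_eq_true, bne_iff_ne, ne_eq,
    beq_iff_eq]
  constructor
  · rintro ⟨⟨-, h1⟩, h2⟩
    exact ⟨by exact_mod_cast h1, h2⟩
  · rintro ⟨h1, h2⟩
    exact ⟨⟨hk0, by exact_mod_cast h1⟩, h2⟩

/-- **`isSqQ3 (−3·(3ᵃ·m))` (`3 ∤ m`) iff `a` is odd and `m ≡ 2 (mod 3)`.** [cite: Serre1973, Ch. II §3.3 Thm 3] -/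
theorem isSqQ3_neg_three_mul_iff {a : ℕ} {m : ℤ} (hm : ¬ (3 : ℤ) ∣ m) :
    isSqQ3 (-3 * ((3 : ℤ) ^ a * m)) = true ↔ Odd a ∧ (m : ZMod 3) = 2 := by
  have hm' : ¬ (3 : ℤ) ∣ -m := fun h => hm (dvd_neg.mp h)
  rw [show (-3 : ℤ) * ((3 : ℤ) ^ a * m) = (3 : ℤ) ^ (a + 1) * (-m) by ring,
    isSqQ3_eq_true_iff hm', Nat.even_add_one, Nat.not_even_iff_odd, Int.cast_neg,
    neg_eq_iff_eq_neg]
  constructor <;> rintro ⟨ho, h⟩ <;> exact ⟨ho, by rw [h]; decide⟩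

/-- **The closed form is the `3`-adic square test**: for `k ≠ 0`, `isSqQ3 k ⟺ k ∈ ℚ₃ײ`
(p4's `JZeroThree.isSquare_padicThree_iff` on `k = 3^{vp 3 k}·unit3 k`). (For `k = 0` the closed form
answers `false` by convention.) [cite: Serre1973, Ch. II §3.3 Thm 3] -/
theorem isSqQ3_iff_isSquare_padic {k : ℤ} (hk : k ≠ 0) :
    isSqQ3 k = true ↔ IsSquare ((k : ℤ) : ℚ_[3]) := by
  obtain ⟨a, m, hm, rfl⟩ := exists_eq_pow_mul_of_ne_zero hk
  rw [isSqQ3_eq_true_iff hm, JZeroThree.isSquare_padicThree_iff hm]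

/-- `−3k ∈ ℚ₃ײ` likewise: for `k ≠ 0`, `isSqQ3 (−3k) ⟺ −3k ∈ ℚ₃ײ`. [cite: Serre1973, Ch. II §3.3 Thm 3] -/
theorem isSqQ3_neg_three_mul_iff_isSquare_padic {k : ℤ} (hk : k ≠ 0) :
    isSqQ3 (-3 * k) = true ↔ IsSquare (((-3) * k : ℤ) : ℚ_[3]) :=
  isSqQ3_iff_isSquare_padic (k := -3 * k) (mul_ne_zero (by norm_num) hk)

/-- `isSqQ3` is invariant under multiplication by `9 = 3²`. [folklore] -/
theorem isSqQ3_nine_mul (n : ℤ) : isSqQ3 (9 * n) = isSqQ3 n := by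
  by_cases hn : n = 0
  · subst hn; decide
  obtain ⟨a, m, hm, rfl⟩ := exists_eq_pow_mul_of_ne_zero hn
  rw [show (9 : ℤ) * ((3 : ℤ) ^ a * m) = (3 : ℤ) ^ (a + 2) * m by ring, Bool.eq_iff_iff,
    isSqQ3_eq_true_iff hm, isSqQ3_eq_true_iff hm, Nat.even_add]
  simp [show Even (2 : ℕ) from ⟨1, rfl⟩]

/-! ### §3 On the pair `(E_k, E_{−27k})` the cube clause is absorbed -/

/-- **T-bit identity (all `k`)**: `hasLocal3Tors k ∨ hasLocal3Tors (−27k) = isSqQ3 k ∨ isSqQ3 (−3k)` —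
on the `3`-isogenous pair the clauses `(−4k ∈ ℚ₃׳ ∧ −3k ∈ ℚ₃ײ)` and `(108k ∈ ℚ₃׳ ∧ 81k ∈ ℚ₃ײ)`
of the single-curve criterion are absorbed by `−27k ∈ ℚ₃ײ ⟺ −3k ∈ ℚ₃ײ` and `81k ∈ ℚ₃ײ ⟺ k ∈ ℚ₃ײ`.
[cite: SilvermanAEC2009, Exercise 3.7] -/
theorem tBit_eq (k : ℤ) :
    (hasLocal3Tors k || hasLocal3Tors (-27 * k)) = (isSqQ3 k || isSqQ3 (-3 * k)) := by
  have h1 : isSqQ3 (-27 * k) = isSqQ3 (-3 * k) := by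
    rw [show (-27 : ℤ) * k = 9 * (-3 * k) by ring, isSqQ3_nine_mul]
  have h2 : isSqQ3 (-3 * (-27 * k)) = isSqQ3 k := by
    rw [show (-3 : ℤ) * (-27 * k) = 9 * (9 * k) by ring, isSqQ3_nine_mul, isSqQ3_nine_mul]
  simp only [hasLocal3Tors, h1, h2]
  rcases Bool.eq_false_or_eq_true (isSqQ3 k) with hx | hx <;>
    rcases Bool.eq_false_or_eq_true (isSqQ3 (-3 * k)) with hy | hy <;> rw [hx, hy] <;> simp

/-- **The T-bit is `false` iff p4's congruence holds**: for `k = 3ᵃ·m`, `3 ∤ m`,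
`¬(hasLocal3Tors k ∨ hasLocal3Tors (−27k)) ⟺ (a even ∧ m ≡ 2) ∨ (a odd ∧ m ≡ 1) (mod 3)`.
[cite: Serre1973, Ch. II §3.3 Thm 3] -/
theorem tBit_eq_false_iff {a : ℕ} {m : ℤ} (hm : ¬ (3 : ℤ) ∣ m) :
    (hasLocal3Tors ((3 : ℤ) ^ a * m) || hasLocal3Tors (-27 * ((3 : ℤ) ^ a * m))) = false ↔
      ((Even a ∧ (m : ZMod 3) = 2) ∨ (Odd a ∧ (m : ZMod 3) = 1)) := by
  rw [tBit_eq, Bool.or_eq_false_iff, Bool.eq_false_iff, Bool.eq_false_iff, ne_eq, ne_eq,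
    isSqQ3_eq_true_iff hm, isSqQ3_neg_three_mul_iff hm]
  have hmz : ((m : ℤ) : ZMod 3) ≠ 0 := by
    rwa [Ne, ZMod.intCast_zmod_eq_zero_iff_dvd]
  have hm12 : (m : ZMod 3) = 1 ∨ (m : ZMod 3) = 2 := by
    have h12 : ∀ z : ZMod 3, z ≠ 0 → z = 1 ∨ z = 2 := by decide
    exact h12 _ hmz
  rcases Nat.even_or_odd a with ha | ha
  · have hna : ¬ Odd a := Nat.not_odd_iff_even.mpr ha
    rcases hm12 with h | h <;> simp [ha, hna, h] <;> decide
  · have hna : ¬ Even a := Nat.not_even_iff_odd.mpr ha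
    rcases hm12 with h | h <;> simp [ha, hna, h] <;> decide

/-! ### §4 The bridge to the O11@3 binders of a curve over `ℚ` (p4's criterion by name) -/

section Curves

open scoped Classical

/-- **BRIDGE.** For any `W : WeierstrassCurve ℚ` with a Mordell model `C • W = (y² = x³ + k)`, `k ≠ 0`
an integer: the records' T-bit `hasLocal3Tors k ∨ hasLocal3Tors (−27k)` is `false` iff BOTH O11@3
local binders hold — `W(ℚ₃)` has no point `Q ≠ 0` with `3Q = 0`, and neither has `W^{(−3)}(ℚ₃)`.
(`X12.JZeroThree.noThreeTorsion_pair_iff_of_mordell_model`, p4, with `a := vp 3 k`, `m := unit3 k`.)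
[cite: SilvermanAEC2009, Exercise 3.7] [cite: Serre1973, Ch. II §3.3 Thm 3] -/
theorem tBit_eq_false_iff_noThreeTorsion_pair (W : WeierstrassCurve ℚ) {C : VariableChange ℚ}
    {k : ℤ} (hk : k ≠ 0) (hW : C • W = mordellCurve ((k : ℤ) : ℚ)) :
    (hasLocal3Tors k || hasLocal3Tors (-27 * k)) = false ↔
      ((∀ Q : (W.baseChange ℚ_[3]).toAffine.Point, (3 : ℕ) • Q = 0 → Q = 0) ∧
        (∀ Q : ((W.quadraticTwist (-3 : ℚ)).baseChange ℚ_[3]).toAffine.Point,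
          (3 : ℕ) • Q = 0 → Q = 0)) := by
  obtain ⟨a, m, hm, rfl⟩ := exists_eq_pow_mul_of_ne_zero hk
  rw [tBit_eq_false_iff hm, JZeroThree.noThreeTorsion_pair_iff_of_mordell_model W hm hW]

/-- Contrapositive reading: the T-bit is `true` iff `W(ℚ₃)` or `W^{(−3)}(ℚ₃)` HAS a point `Q ≠ 0`
with `3Q = 0`. [cite: SilvermanAEC2009, Exercise 3.7] -/
theorem tBit_eq_true_iff_exists_threeTorsion (W : WeierstrassCurve ℚ) {C : VariableChange ℚ}
    {k : ℤ} (hk : k ≠ 0) (hW : C • W = mordellCurve ((k : ℤ) : ℚ)) :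
    (hasLocal3Tors k || hasLocal3Tors (-27 * k)) = true ↔
      ((∃ Q : (W.baseChange ℚ_[3]).toAffine.Point, Q ≠ 0 ∧ (3 : ℕ) • Q = 0) ∨
        (∃ Q : ((W.quadraticTwist (-3 : ℚ)).baseChange ℚ_[3]).toAffine.Point,
          Q ≠ 0 ∧ (3 : ℕ) • Q = 0)) := by
  have h := tBit_eq_false_iff_noThreeTorsion_pair W hk hW
  rw [Bool.eq_false_iff] at h
  constructor
  · intro ht
    by_contra hc
    push Not at hc
    exact (h.mpr ⟨fun Q hQ => by_contra fun hne => (hc.1 Q hne) hQ,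
      fun Q hQ => by_contra fun hne => (hc.2 Q hne) hQ⟩) ht
  · rintro hex
    by_contra hf
    obtain ⟨h1, h2⟩ := h.mp hf
    rcases hex with ⟨Q, hne, hQ⟩ | ⟨Q, hne, hQ⟩
    · exact hne (h1 Q hQ)
    · exact hne (h2 Q hQ)

/-! ### §5 Record level: `regimeCode` and a consistent `RegimeRow` decide the binders of the curve -/

/-- `regimeCode k tam ≠ 1` (not regime T) iff the T-bit is `false`. [folklore] -/
theorem regimeCode_ne_one_iff (k : ℤ) (tam : List (ℕ × ℕ)) :
    regimeCode k tam ≠ 1 ↔ (hasLocal3Tors k || hasLocal3Tors (-27 * k)) = false := by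
  unfold regimeCode
  generalize (hasLocal3Tors k || hasLocal3Tors (-27 * k)) = b
  generalize awayOK tam = w
  cases b <;> cases w <;> decide

/-- `regimeCode k tam = 1` (regime T) iff the T-bit is `true`. [folklore] -/
theorem regimeCode_eq_one_iff (k : ℤ) (tam : List (ℕ × ℕ)) :
    regimeCode k tam = 1 ↔ (hasLocal3Tors k || hasLocal3Tors (-27 * k)) = true := by
  unfold regimeCode
  generalize (hasLocal3Tors k || hasLocal3Tors (-27 * k)) = b
  generalize awayOK tam = w
  cases b <;> cases w <;> decide

/-- `regimeCode k tam = 0` (regime N) iff the T-bit is `false` and the away bit is `true`. [folklore] -/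
theorem regimeCode_eq_zero_iff (k : ℤ) (tam : List (ℕ × ℕ)) :
    regimeCode k tam = 0 ↔
      (hasLocal3Tors k || hasLocal3Tors (-27 * k)) = false ∧ awayOK tam = true := by
  unfold regimeCode
  generalize (hasLocal3Tors k || hasLocal3Tors (-27 * k)) = b
  generalize awayOK tam = w
  cases b <;> cases w <;> decide

/-- `regimeCode k tam = 2` (regime V) iff the T-bit is `false` and the away bit is `false`. [folklore] -/
theorem regimeCode_eq_two_iff (k : ℤ) (tam : List (ℕ × ℕ)) :
    regimeCode k tam = 2 ↔
      (hasLocal3Tors k || hasLocal3Tors (-27 * k)) = false ∧ awayOK tam = false := by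
  unfold regimeCode
  generalize (hasLocal3Tors k || hasLocal3Tors (-27 * k)) = b
  generalize awayOK tam = w
  cases b <;> cases w <;> decide

namespace RegimeRow

/-- A consistent record has `k ≠ 0`. [folklore] -/
theorem k_ne_zero_of_consistent {r : RegimeRow} (h : r.consistent = true) : r.k ≠ 0 := by
  simp only [RegimeRow.consistent, Bool.and_eq_true, bne_iff_ne, ne_eq] at h
  exact h.1.1.1.1.1

/-- **Regime ≠ T ⟺ both O11@3 binders.** For a consistent regime record `r` and ANY `W` over `ℚ`
with Mordell model `C • W = (y² = x³ + r.k)`: `r.regime ≠ 1` iff `W(ℚ₃)[3] = 0` and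
`W^{(−3)}(ℚ₃)[3] = 0`. [cite: SilvermanAEC2009, Exercise 3.7] -/
theorem regime_ne_one_iff {r : RegimeRow} (h : r.consistent = true) (W : WeierstrassCurve ℚ)
    {C : VariableChange ℚ} (hW : C • W = mordellCurve ((r.k : ℤ) : ℚ)) :
    r.regime ≠ 1 ↔
      ((∀ Q : (W.baseChange ℚ_[3]).toAffine.Point, (3 : ℕ) • Q = 0 → Q = 0) ∧
        (∀ Q : ((W.quadraticTwist (-3 : ℚ)).baseChange ℚ_[3]).toAffine.Point,
          (3 : ℕ) • Q = 0 → Q = 0)) := by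
  rw [(regime_eq_of_consistent h).1, regimeCode_ne_one_iff,
    tBit_eq_false_iff_noThreeTorsion_pair W (k_ne_zero_of_consistent h) hW]

/-- **Regime N ⟺ the O11@3 sub-leaf**: `r.regime = 0` iff both binders hold and the away bit
`awayOK r.tam` (no `3 ∣ c_ℓ` at a bad `ℓ ≡ 1 (mod 3)` in the recorded Tamagawa list) is `true`.
[cite: SilvermanAEC2009, Exercise 3.7] -/
theorem regime_eq_zero_iff {r : RegimeRow} (h : r.consistent = true) (W : WeierstrassCurve ℚ)
    {C : VariableChange ℚ} (hW : C • W = mordellCurve ((r.k : ℤ) : ℚ)) :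
    r.regime = 0 ↔
      (((∀ Q : (W.baseChange ℚ_[3]).toAffine.Point, (3 : ℕ) • Q = 0 → Q = 0) ∧
        (∀ Q : ((W.quadraticTwist (-3 : ℚ)).baseChange ℚ_[3]).toAffine.Point,
          (3 : ℕ) • Q = 0 → Q = 0)) ∧ awayOK r.tam = true) := by
  rw [(regime_eq_of_consistent h).1, regimeCode_eq_zero_iff,
    tBit_eq_false_iff_noThreeTorsion_pair W (k_ne_zero_of_consistent h) hW]

/-- **Regime V**: `r.regime = 2` iff both binders hold and the away bit is `false`
(`3 ∣ c_ℓ` at some bad `ℓ ≡ 1 (mod 3)` of the recorded Tamagawa list). [cite: SilvermanAEC2009, Exercise 3.7] -/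
theorem regime_eq_two_iff {r : RegimeRow} (h : r.consistent = true) (W : WeierstrassCurve ℚ)
    {C : VariableChange ℚ} (hW : C • W = mordellCurve ((r.k : ℤ) : ℚ)) :
    r.regime = 2 ↔
      (((∀ Q : (W.baseChange ℚ_[3]).toAffine.Point, (3 : ℕ) • Q = 0 → Q = 0) ∧
        (∀ Q : ((W.quadraticTwist (-3 : ℚ)).baseChange ℚ_[3]).toAffine.Point,
          (3 : ℕ) • Q = 0 → Q = 0)) ∧ awayOK r.tam = false) := by
  rw [(regime_eq_of_consistent h).1, regimeCode_eq_two_iff,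
    tBit_eq_false_iff_noThreeTorsion_pair W (k_ne_zero_of_consistent h) hW]

/-- **Regime T**: `r.regime = 1` iff `W(ℚ₃)` or `W^{(−3)}(ℚ₃)` has a point `Q ≠ 0` with `3Q = 0`.
[cite: SilvermanAEC2009, Exercise 3.7] -/
theorem regime_eq_one_iff {r : RegimeRow} (h : r.consistent = true) (W : WeierstrassCurve ℚ)
    {C : VariableChange ℚ} (hW : C • W = mordellCurve ((r.k : ℤ) : ℚ)) :
    r.regime = 1 ↔
      ((∃ Q : (W.baseChange ℚ_[3]).toAffine.Point, Q ≠ 0 ∧ (3 : ℕ) • Q = 0) ∨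
        (∃ Q : ((W.quadraticTwist (-3 : ℚ)).baseChange ℚ_[3]).toAffine.Point,
          Q ≠ 0 ∧ (3 : ℕ) • Q = 0)) := by
  rw [(regime_eq_of_consistent h).1, regimeCode_eq_one_iff,
    tBit_eq_true_iff_exists_threeTorsion W (k_ne_zero_of_consistent h) hW]

end RegimeRow

end Curves

end Summit.BirchSwinnertonDyer.Rank1Residual.X12.CMRamifiedRecords
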